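import Literature.Analysis.FluidPDE.VectorCalculus
import Literature.Analysis.FluidPDE.NewtonKernel
import Literature.Analysis.Calculus.SmoothCutoff
import Mathlib.MeasureTheory.Integral.MeanInequalities
import Mathlib.MeasureTheory.Function.LpSeminorm.CompareExp
import HarnessLib

/-!
# Toolkit for Leray's separation of energy: the two-radius cutoff, the Frobenius norm, and
# Hölder-type inequalities in `ℝ≥0∞`

Analysis/FluidPDE support file (folklore real analysis) serving
`FluidPDE/LeraySeparationOfEnergy` (the discharge of the `tail` estimate inside
`Literature.Analysis.FluidPDE.leray_regularised_wellposed`; Leray 1934, Ch. V §27;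
Ożański–Pooley 2018, Lemma 6.34). Everything here is independent of the Navier–Stokes equations:

* `exists_norm_fderiv_radialCutoff_le_div` — the gradient bound `‖Dθ_{r₀,r₁}‖ ≤ C/(r₁ − r₀)` for
  the tree's smooth radial cutoff `radialCutoff r₀ r₁` (`FluidPDE/NewtonKernel`), uniformly in
  `0 ≤ r₀ < r₁` (Leray's ramp `f` has `|∇f| = 1/(R₂ − R₁)`);
* `norm_sq_le_frobeniusNormSq` — `‖L‖² ≤ |L|²_F`, so that the `L²` norm of `Du` with the operator
  norm (Mathlib's Sobolev inequality) is dominated by the Frobenius dissipation of the energy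
  equality;
* Hölder/Cauchy–Schwarz repackagings in `ℝ≥0∞` (no integrability presupposed):
  `∫⁻ ‖f‖ₑ‖g‖ₑ ≤ ‖f‖₂‖g‖₂`, `‖|f||g|‖₂ ≤ ‖f‖₄‖g‖₄`, `‖|f|²‖₂ = ‖f‖₄²`, `‖|f|³‖₂ = ‖f‖₆³`, the
  `L⁴` interpolation `‖f‖₄⁴ ≤ ‖f‖₂‖f‖₆³`, and Hölder in time
  `∫_I D^{3/4} ≤ (∫_I D)^{3/4}|I|^{1/4}`, `∫_I D^{1/2} ≤ (∫_I D)^{1/2}|I|^{1/2}` on `I = (0, t)`.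

## Mathlib / tree search

Mathlib: `ENNReal.lintegral_mul_le_Lp_mul_Lq`, `eLpNorm_le_eLpNorm_mul_eLpNorm'_of_norm`,
`eLpNorm_norm_rpow`, `Real.smoothTransition` (used). Tree: `radialCutoff` and its API
(`NewtonKernel`), fixed-ratio gradient bounds only (`exists_norm_fderiv_radialCutoff_le` in
`SingularKernelTruncation`, `exists_norm_fderiv_cutoff_le` in `WholeSpaceIBP`) — the two-radius
bound with the `1/(r₁ − r₀)` rate is new; `Calculus.exists_bound_deriv_smoothTransition`
(`Calculus/SmoothCutoff`, used); `frobeniusNormSq`, `norm_apply_sq_le_frobeniusNormSq` (single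
basis vector only).

## References

* J. Leray, Acta Math. 63 (1934), Ch. V §27, p. 233 (the ramp `f` and `|∇f|`).
* W. S. Ożański, B. C. Pooley, arXiv:1708.09787 = LMS Lecture Note Ser. 452 (2018), proof of
  Lemma 6.34.
-/

noncomputable section

open MeasureTheory TopologicalSpace Set Function Filter InnerProductSpace
open scoped ENNReal NNReal RealInnerProductSpace Topology

namespace Literature.Analysis.FluidPDE

/-! ### Toolkit: the two-radius radial cutoff and the Frobenius norm -/

section Toolkit

variable {E : Type*} [NormedAddCommGroup E] [InnerProductSpace ℝ E]

/-- **Gradient bound for the two-radius radial cutoff.** There is an absolute constant `C` (twice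
a bound for `|smoothTransition'|`) such that for all `0 ≤ r₀ < r₁` the smooth radial cutoff
`θ = radialCutoff r₀ r₁` (`= 1` on `|z| ≤ r₀`, `= 0` on `|z| ≥ r₁`) satisfies
`‖Dθ(z)‖ ≤ C / (r₁ − r₀)` everywhere (chain rule: `Dθ(z) = Θ'((r₁² − |z|²)/(r₁² − r₀²)) · (−2⟪z, ·⟫)/(r₁² − r₀²)`,
and `Θ' = 0` unless `|z| ≤ r₁`, where `2|z|/(r₁² − r₀²) ≤ 2/(r₁ − r₀)`) — the property
`|∇f| ≤ 1/(R₂ − R₁)` of Leray's ramp (Leray 1934, §27; Ożański–Pooley 2018, proof of Lemma 6.34)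
for a smooth substitute. [folklore] -/
theorem exists_norm_fderiv_radialCutoff_le_div :
    ∃ C : ℝ, 0 ≤ C ∧ ∀ ⦃r₀ r₁ : ℝ⦄, 0 ≤ r₀ → r₀ < r₁ →
      ∀ z : E, ‖fderiv ℝ (radialCutoff r₀ r₁ : E → ℝ) z‖ ≤ C / (r₁ - r₀) := by
  obtain ⟨D, hD0, hD⟩ := Calculus.exists_bound_deriv_smoothTransition
  refine ⟨2 * D, by positivity, fun r₀ r₁ h₀ h₁ z => ?_⟩
  have hd : 0 < r₁ ^ 2 - r₀ ^ 2 := by nlinarith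
  have hr : 0 < r₁ - r₀ := sub_pos.2 h₁
  set a : ℝ := (r₁ ^ 2 - ‖z‖ ^ 2) / (r₁ ^ 2 - r₀ ^ 2) with ha
  have h1 : HasFDerivAt (fun z : E => ‖z‖ ^ 2) (2 • innerSL ℝ z) z :=
    (hasStrictFDerivAt_norm_sq z).hasFDerivAt
  have h2 : HasDerivAt (fun σ : ℝ => (r₁ ^ 2 - σ) / (r₁ ^ 2 - r₀ ^ 2)) (-(r₁ ^ 2 - r₀ ^ 2)⁻¹)
      (‖z‖ ^ 2) := by
    have := ((hasDerivAt_id (‖z‖ ^ 2)).const_sub (r₁ ^ 2)).div_const (r₁ ^ 2 - r₀ ^ 2)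
    simpa only [id_eq, neg_div, one_div] using this
  have h3 : HasDerivAt Real.smoothTransition (deriv Real.smoothTransition a) a :=
    (Calculus.differentiable_smoothTransition a).hasDerivAt
  have h23 : HasDerivAt (cutoffProfile r₀ r₁)
      (deriv Real.smoothTransition a * -(r₁ ^ 2 - r₀ ^ 2)⁻¹) (‖z‖ ^ 2) := by
    have := h3.comp (‖z‖ ^ 2) h2
    exact this
  have hcomp : HasFDerivAt (radialCutoff r₀ r₁ : E → ℝ)
      ((deriv Real.smoothTransition a * -(r₁ ^ 2 - r₀ ^ 2)⁻¹) • (2 • innerSL ℝ z)) z :=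
    h23.comp_hasFDerivAt z h1
  rw [← Nat.cast_smul_eq_nsmul ℝ (2 : ℕ) (innerSL ℝ z), Nat.cast_ofNat] at hcomp
  rw [hcomp.fderiv, norm_smul, norm_smul, innerSL_apply_norm, Real.norm_eq_abs, Real.norm_eq_abs,
    abs_mul, abs_neg, abs_inv, abs_of_pos hd, abs_of_pos (two_pos : (0 : ℝ) < 2)]
  rcases le_or_gt ‖z‖ r₁ with hz | hz
  · -- `|z| ≤ r₁`: `|Θ'| ≤ D` and `2|z|/(r₁² − r₀²) ≤ 2/(r₁ − r₀)`
    have hz0 : 0 ≤ ‖z‖ := norm_nonneg z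
    calc |deriv Real.smoothTransition a| * (r₁ ^ 2 - r₀ ^ 2)⁻¹ * (2 * ‖z‖)
        ≤ D * (r₁ ^ 2 - r₀ ^ 2)⁻¹ * (2 * r₁) := by
          gcongr
          · exact hD a
      _ ≤ 2 * D / (r₁ - r₀) := by
          rw [div_eq_mul_inv, show r₁ ^ 2 - r₀ ^ 2 = (r₁ - r₀) * (r₁ + r₀) by ring, mul_inv]
          have h3 : r₁ * (r₁ + r₀)⁻¹ ≤ 1 := by
            rw [mul_inv_le_iff₀ (by linarith : 0 < r₁ + r₀)]
            linarith
          have h4 : 0 ≤ (r₁ - r₀)⁻¹ := inv_nonneg.2 hr.le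
          nlinarith [mul_nonneg hD0 h4]
  · -- `|z| > r₁`: `a < 0`, so `Θ'(a) = 0`
    have ha0 : a ≤ 0 := by
      rw [ha]
      exact div_nonpos_of_nonpos_of_nonneg (by nlinarith) hd.le
    rw [Calculus.deriv_smoothTransition_of_nonpos ha0, abs_zero, zero_mul, zero_mul]
    positivity

variable [FiniteDimensional ℝ E]
variable {F' : Type*} [NormedAddCommGroup F'] [InnerProductSpace ℝ F']

/-- **The operator norm is dominated by the Frobenius norm**: `‖L‖² ≤ |L|²_F = Σᵢ ‖L eᵢ‖²`
(expand `v = Σᵢ ⟪eᵢ, v⟫ eᵢ` and use the Cauchy–Schwarz inequality for finite sums). Twin of the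
tree's `sq_opNorm_le_frobeniusNormSq` (`TaoEnstrophyLocalisationProofs`, whose import closure —
Tao's localisation framework — is kept out of this file's). [folklore] -/
theorem norm_sq_le_frobeniusNormSq (L : E →L[ℝ] F') : ‖L‖ ^ 2 ≤ frobeniusNormSq L := by
  set b := stdOrthonormalBasis ℝ E with hb
  have hF : frobeniusNormSq L = ∑ i, ‖L (b i)‖ ^ 2 := rfl
  have hnn : 0 ≤ frobeniusNormSq L := frobeniusNormSq_nonneg L
  have hle : ‖L‖ ≤ Real.sqrt (frobeniusNormSq L) := by
    refine ContinuousLinearMap.opNorm_le_bound _ (Real.sqrt_nonneg _) fun v => ?_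
    have hv : L v = ∑ i, ⟪b i, v⟫ • L (b i) := by
      conv_lhs => rw [← b.sum_repr' v]
      simp only [map_sum, map_smul]
    have hvv : ∑ i, |⟪b i, v⟫| ^ 2 = ‖v‖ ^ 2 := by
      simp only [sq_abs]
      rw [← real_inner_self_eq_norm_sq, ← b.sum_inner_mul_inner v v]
      refine Finset.sum_congr rfl fun i _ => ?_
      rw [real_inner_comm (b i) v]
      ring
    have hS : ∑ i, |⟪b i, v⟫| * ‖L (b i)‖ ≤ Real.sqrt (frobeniusNormSq L) * ‖v‖ := by
      have hcs := Finset.sum_mul_sq_le_sq_mul_sq Finset.univ (fun i => |⟪b i, v⟫|) fun i => ‖L (b i)‖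
      have h1 : |∑ i, |⟪b i, v⟫| * ‖L (b i)‖| ≤
          Real.sqrt ((∑ i, |⟪b i, v⟫| ^ 2) * ∑ i, ‖L (b i)‖ ^ 2) := Real.abs_le_sqrt hcs
      rw [hvv, ← hF, Real.sqrt_mul (sq_nonneg _), Real.sqrt_sq (norm_nonneg _)] at h1
      linarith [le_abs_self (∑ i, |⟪b i, v⟫| * ‖L (b i)‖)]
    calc ‖L v‖ = ‖∑ i, ⟪b i, v⟫ • L (b i)‖ := by rw [hv]
      _ ≤ ∑ i, ‖⟪b i, v⟫ • L (b i)‖ := norm_sum_le _ _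
      _ = ∑ i, |⟪b i, v⟫| * ‖L (b i)‖ := by simp [norm_smul]
      _ ≤ Real.sqrt (frobeniusNormSq L) * ‖v‖ := hS
  nlinarith [Real.sq_sqrt hnn, Real.sqrt_nonneg (frobeniusNormSq L), norm_nonneg L]

/-- `‖L‖ₑ² ≤ ofReal |L|²_F` (natural-number exponent), the extended form of
`norm_sq_le_frobeniusNormSq`; twin of `enorm_sq_le_ofReal_frobeniusNormSq` (`NSWeakStrongUniquenessProofs`,
`rpow` exponent) and of `enorm_pow_two_le_ofReal_frobeniusNormSq` (`CylinderAubinLions`, `ℝ³` only),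
both in import closures disjoint from this file's. [folklore] -/
theorem enorm_opNorm_sq_le_ofReal_frobeniusNormSq (L : E →L[ℝ] F') :
    ‖L‖ₑ ^ 2 ≤ ENNReal.ofReal (frobeniusNormSq L) := by
  rw [← ofReal_norm, ← ENNReal.ofReal_pow (norm_nonneg _)]
  exact ENNReal.ofReal_le_ofReal (norm_sq_le_frobeniusNormSq L)

end Toolkit


/-! ### Hölder-type toolkit in `ℝ≥0∞` -/

section Holder

variable {α : Type*} [MeasurableSpace α] {μ : Measure α}
variable {G₁ G₂ : Type*} [NormedAddCommGroup G₁] [NormedAddCommGroup G₂]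

/-- `1/4 + 1/4 = 1/2` as a Hölder triple (a private copy of the tree's
`holderTriple_four_four_two` of `LerayHopfH1Test`, whose import closure is disjoint). [folklore] -/
private theorem holderTriple_four_four_two' : ENNReal.HolderTriple 4 4 2 := ⟨by
  have h4 : (4 : ℝ≥0∞) = 2 * 2 := by norm_num
  rw [h4, ENNReal.mul_inv (by simp) (by simp), ← two_mul, ← mul_assoc,
    ENNReal.mul_inv_cancel (by simp) (by simp), one_mul]⟩

/-- **Cauchy–Schwarz in `ℝ≥0∞`**: `∫⁻ ‖f‖ₑ ‖g‖ₑ ≤ ‖f‖_{L²} ‖g‖_{L²}`. [folklore] -/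
theorem lintegral_enorm_mul_enorm_le {f : α → G₁} {g : α → G₂} (hf : AEStronglyMeasurable f μ)
    (hg : AEStronglyMeasurable g μ) :
    ∫⁻ x, ‖f x‖ₑ * ‖g x‖ₑ ∂μ ≤ eLpNorm f 2 μ * eLpNorm g 2 μ := by
  have h := eLpNorm_le_eLpNorm_mul_eLpNorm'_of_norm (p := 2) (q := 2) (r := 1) hf hg
    (fun a b => ‖a‖ * ‖b‖) 1 (Eventually.of_forall fun x => by simp)
  rw [eLpNorm_one_eq_lintegral_enorm] at h
  simp only [ENNReal.coe_one, one_mul] at h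
  refine le_trans (le_of_eq (lintegral_congr fun x => ?_)) h
  rw [enorm_mul, enorm_norm, enorm_norm]

/-- `‖ |f|·|g| ‖_{L²} ≤ ‖f‖_{L⁴} ‖g‖_{L⁴}`. [folklore] -/
theorem eLpNorm_norm_mul_norm_two_le {f : α → G₁} {g : α → G₂} (hf : AEStronglyMeasurable f μ)
    (hg : AEStronglyMeasurable g μ) :
    eLpNorm (fun x => ‖f x‖ * ‖g x‖) 2 μ ≤ eLpNorm f 4 μ * eLpNorm g 4 μ := by
  haveI := holderTriple_four_four_two'
  have h := eLpNorm_le_eLpNorm_mul_eLpNorm'_of_norm (p := 4) (q := 4) (r := 2) hf hg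
    (fun a b => ‖a‖ * ‖b‖) 1 (Eventually.of_forall fun x => by simp)
  simpa using h

/-- `‖ ‖f‖² ‖_{L²} = ‖f‖²_{L⁴}`. [folklore] -/
theorem eLpNorm_norm_sq_two (f : α → G₁) :
    eLpNorm (fun x => ‖f x‖ ^ 2) 2 μ = eLpNorm f 4 μ ^ 2 := by
  have h := eLpNorm_norm_rpow f (p := 2) (q := 2) (μ := μ) two_pos
  simp only [Real.rpow_two] at h
  rw [h]
  norm_num

/-- `‖ ‖f‖³ ‖_{L²} = ‖f‖³_{L⁶}`. [folklore] -/
theorem eLpNorm_norm_cube_two (f : α → G₁) :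
    eLpNorm (fun x => ‖f x‖ ^ 3) 2 μ = eLpNorm f 6 μ ^ 3 := by
  have h := eLpNorm_norm_rpow f (p := 2) (q := 3) (μ := μ) three_pos
  have e : ∀ x, ‖f x‖ ^ (3 : ℝ) = ‖f x‖ ^ (3 : ℕ) := fun x => by exact_mod_cast Real.rpow_natCast ‖f x‖ 3
  simp only [e] at h
  rw [h]
  have e2 : (2 : ℝ≥0∞) * ENNReal.ofReal 3 = 6 := by rw [ENNReal.ofReal_ofNat]; norm_num
  rw [e2]
  exact_mod_cast ENNReal.rpow_natCast _ 3

/-- **`L⁴` interpolation** in `ℝ≥0∞`: `‖f‖⁴_{L⁴} ≤ ‖f‖_{L²} ‖f‖³_{L⁶}` (Cauchy–Schwarz on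
`|f| · |f|³`). [folklore] -/
theorem eLpNorm_four_pow_four_le {f : α → G₁} (hf : AEStronglyMeasurable f μ) :
    eLpNorm f 4 μ ^ 4 ≤ eLpNorm f 2 μ * eLpNorm f 6 μ ^ 3 := by
  have h := lintegral_enorm_mul_enorm_le (μ := μ) hf.norm (g := fun x => ‖f x‖ ^ 3) (hf.norm.pow 3)
  rw [eLpNorm_norm, eLpNorm_norm_cube_two] at h
  refine le_trans (le_of_eq ?_) h
  have e4 : eLpNorm f 4 μ ^ 4 = ∫⁻ x, ‖f x‖ₑ ^ 4 ∂μ := by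
    have := eLpNorm_eq_lintegral_rpow_enorm_toReal (p := 4) (by norm_num) (by norm_num) (f := f) (μ := μ)
    rw [this]
    simp only [ENNReal.toReal_ofNat, one_div]
    rw [← ENNReal.rpow_natCast, ← ENNReal.rpow_mul]
    norm_num
  rw [e4]
  refine lintegral_congr fun x => ?_
  rw [enorm_norm, Real.enorm_eq_ofReal_abs, abs_of_nonneg (pow_nonneg (norm_nonneg _) 3),
    ENNReal.ofReal_pow (norm_nonneg _), ofReal_norm]
  ring

/-- Hölder in time, exponent `3/4`: `∫_I D^{3/4} ≤ (∫_I D)^{3/4} |I|^{1/4}` on `I = (0, t)`. [folklore] -/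
theorem lintegral_Ioo_rpow_three_quarters_le {D : ℝ → ℝ≥0∞} {t : ℝ}
    (hD : AEMeasurable D (volume.restrict (Ioo 0 t))) :
    ∫⁻ r in Ioo 0 t, D r ^ (3 / 4 : ℝ) ≤
      (∫⁻ r in Ioo 0 t, D r) ^ (3 / 4 : ℝ) * ENNReal.ofReal t ^ (1 / 4 : ℝ) := by
  have hpq : (4 / 3 : ℝ).HolderConjugate 4 := Real.holderConjugate_iff.2 ⟨by norm_num, by norm_num⟩
  have h := ENNReal.lintegral_mul_le_Lp_mul_Lq (volume.restrict (Ioo 0 t)) hpq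
    (f := fun r => D r ^ (3 / 4 : ℝ)) (g := fun _ => 1) (hD.pow_const _) aemeasurable_const
  simp only [Pi.mul_apply, mul_one, ENNReal.one_rpow, lintegral_const, Measure.restrict_apply,
    MeasurableSet.univ, univ_inter, Real.volume_Ioo, sub_zero, one_mul] at h
  refine h.trans (le_of_eq ?_)
  congr 1
  · rw [show (1 : ℝ) / (4 / 3) = 3 / 4 by norm_num]
    congr 1
    refine lintegral_congr fun r => ?_
    rw [← ENNReal.rpow_mul]
    norm_num

/-- Hölder in time, exponent `1/2`: `∫_I D^{1/2} ≤ (∫_I D)^{1/2} |I|^{1/2}` on `I = (0, t)`. [folklore] -/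
theorem lintegral_Ioo_rpow_half_le {D : ℝ → ℝ≥0∞} {t : ℝ}
    (hD : AEMeasurable D (volume.restrict (Ioo 0 t))) :
    ∫⁻ r in Ioo 0 t, D r ^ (1 / 2 : ℝ) ≤
      (∫⁻ r in Ioo 0 t, D r) ^ (1 / 2 : ℝ) * ENNReal.ofReal t ^ (1 / 2 : ℝ) := by
  have h := ENNReal.lintegral_mul_le_Lp_mul_Lq (volume.restrict (Ioo 0 t))
    Real.HolderConjugate.two_two (f := fun r => D r ^ (1 / 2 : ℝ)) (g := fun _ => 1) (hD.pow_const _)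
    aemeasurable_const
  simp only [Pi.mul_apply, mul_one, ENNReal.one_rpow, lintegral_const, Measure.restrict_apply,
    MeasurableSet.univ, univ_inter, Real.volume_Ioo, sub_zero, one_mul] at h
  refine h.trans (le_of_eq ?_)
  congr 2
  refine lintegral_congr fun r => ?_
  rw [← ENNReal.rpow_mul]
  norm_num

end Holder

end Literature.Analysis.FluidPDE

end
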